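import Mathlib
import Literature.Computability.AlgebraicComplexity.LinSubst
import Summits.ValiantsHypothesis.ValiantsHypothesis.Theorems.BorderApolarityFixedWitnessObstructionQPH0Elementary

/-!
# Border apolarity, crux `ToricWitnessObstructionQP` (stmt-ValiantsHypothesis-14753) — line `Sketch`,
# reshape 4: stub `stub_stabTorus` (pattern-torus stability, unpacking W4, II)

Route `ValiantsHypothesis/BorderApolarity`, crux item `stmt-ValiantsHypothesis-14753`, line `Sketch`,
reshape 4, stub `stub_stabTorus`.

Notation: `σ := Fin m × Fin m`, the "own" variables are `ess a := (m-n ≤ a.1 ∧ m-n ≤ a.2) ∨ a = (0,0)`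
(the `Y`-block and `ℓ = (0,0)`), the others are "unused".  The raw stability W4, transported through
`J_k = {D : pᵀ D ∈ J'_k}` with `p` fixing the own variables (own columns of `p` are coordinate
vectors), says that `J'_k` is stable under `D ↦ linSubst ((p⁻¹ M p)ᵀ) D` for every `M ∈ H₀(n,m)`.
For a clean pattern-torus element `t` (`t = 1` on the unused variables, rank-one on the block,
character `1`) the diagonal matrix `Dt := diagonal t` lies in `H₀`, and

  `p⁻¹ · Dt · p = Dt · (1 + E)`,  `E := Dt⁻¹ p⁻¹ Dt p - 1` supported on own rows × unused columns

(pure bookkeeping with the coordinate own columns of `p` and `p⁻¹`).  Hence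
`(p⁻¹ Dt p)ᵀ = (1 + Eᵀ) · Dt`, and the factor `1 + Eᵀ` is removed by the GIVEN Hom-stability
(`C := -Eᵀ`, using `Eᵀ Eᵀ = 0`), leaving `linSubst Dt D ∈ J'_k`.
-/

open MvPolynomial Filter
open scoped BigOperators Matrix
open Literature.Computability.AlgebraicComplexity

-- the mandated summit-side namespace repeats a component by design (single-problem summit)
set_option linter.dupNamespace false

namespace Summit.ValiantsHypothesis.ValiantsHypothesis.Theorems.BorderApolarityToricWitnessObstructionQP

/-- A unipotent substitution `1 + N` with `N² = 0` is undone by `1 - N`: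
`linSubst (1 + -N) (linSubst (1 + N) f) = f`. [folklore] -/
theorem stabTorus_linSubst_cancel {σ : Type*} [Fintype σ] [DecidableEq σ] (N : Matrix σ σ ℂ)
    (hN : N * N = 0) (f : MvPolynomial σ ℂ) :
    linSubst σ ℂ (1 + -N) (linSubst σ ℂ (1 + N) f) = f := by
  have h : (1 + -N) * (1 + N) = 1 := by
    have h' : (1 + -N) * (1 + N) = 1 - N * N := by noncomm_ring
    rw [h', hN, sub_zero]
  calc linSubst σ ℂ (1 + -N) (linSubst σ ℂ (1 + N) f)
      = linSubst σ ℂ ((1 + -N) * (1 + N)) f := by rw [linSubst_mul]; rfl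
    _ = f := by rw [h, linSubst_one]; rfl

/-- A matrix supported on `ess`-rows × `¬ess`-columns squares to zero. [folklore] -/
theorem stabTorus_mul_self_eq_zero {σ : Type*} [Fintype σ] (ess : σ → Prop) (E : Matrix σ σ ℂ)
    (hE : ∀ b a, E b a ≠ 0 → ess b ∧ ¬ ess a) : E * E = 0 := by
  ext b a
  rw [Matrix.mul_apply, Matrix.zero_apply]
  refine Finset.sum_eq_zero fun i _ => ?_
  by_cases h1 : E b i = 0
  · rw [h1, zero_mul]
  · by_cases h2 : E i a = 0
    · rw [h2, mul_zero]
    · exact ((hE b i h1).2 (hE i a h2).1).elim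

/-- If `Pi * P = 1` and the `ess`-columns of `P` are coordinate vectors, then so are the
`ess`-columns of `Pi`. [folklore] -/
theorem stabTorus_inv_col {σ : Type*} [Fintype σ] [DecidableEq σ] (ess : σ → Prop)
    (P Pi : Matrix σ σ ℂ) (hPiP : Pi * P = 1)
    (hPcol : ∀ a, ess a → ∀ b, P b a = if b = a then 1 else 0) :
    ∀ a, ess a → ∀ b, Pi b a = if b = a then 1 else 0 := by
  intro a ha b
  have h1 := congrFun (congrFun hPiP b) a
  rw [Matrix.mul_apply, Matrix.one_apply] at h1
  simp_rw [hPcol a ha, mul_ite, mul_one, mul_zero, Finset.sum_ite_eq', Finset.mem_univ,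
    if_true] at h1
  exact h1

/-- **Conjugating a clean torus element by a matrix fixing the own variables.**  If `Pi * P = 1`,
the `ess`-columns of `P` are coordinate vectors and `t = 1` off `ess` (`t` nowhere zero), then the
correction matrix `E := diagonal t⁻¹ * (Pi * diagonal t * P) - 1` is supported on
`ess`-rows × `¬ess`-columns. [folklore] -/
theorem stabTorus_corr_support {σ : Type*} [Fintype σ] [DecidableEq σ] (ess : σ → Prop)
    (P Pi : Matrix σ σ ℂ) (hPiP : Pi * P = 1)
    (hPcol : ∀ a, ess a → ∀ b, P b a = if b = a then 1 else 0)
    (t : σ → ℂ) (ht0 : ∀ i, t i ≠ 0) (ht1 : ∀ z, ¬ ess z → t z = 1) :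
    ∀ b a, (Matrix.diagonal (fun i => (t i)⁻¹) * (Pi * Matrix.diagonal t * P) - 1) b a ≠ 0 →
      ess b ∧ ¬ ess a := by
  have hPicol := stabTorus_inv_col ess P Pi hPiP hPcol
  intro b a h
  by_contra hne
  apply h
  rw [Matrix.sub_apply, Matrix.diagonal_mul, Matrix.mul_apply, Matrix.one_apply]
  simp only [Matrix.mul_diagonal]
  by_cases ha : ess a
  · -- own column `a`: `P i a = δ i a`, `Pi b a = δ b a`
    simp_rw [hPcol a ha, mul_ite, mul_one, mul_zero, Finset.sum_ite_eq', Finset.mem_univ, if_true,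
      hPicol a ha]
    by_cases hba : b = a
    · rw [if_pos hba, hba, one_mul, inv_mul_cancel₀ (ht0 a), sub_self]
    · rw [if_neg hba, zero_mul, mul_zero, sub_zero]
  · -- unused column `a` and (forced) unused row `b`: `t b = 1`, and the `t i` disappear termwise
    have hb : ¬ ess b := fun hb => hne ⟨hb, ha⟩
    have hsum : ∑ i, Pi b i * t i * P i a = ∑ i, Pi b i * P i a := by
      refine Finset.sum_congr rfl fun i _ => ?_
      by_cases hi : ess i
      · have h0 : Pi b i = 0 := by
          rw [hPicol i hi, if_neg]
          rintro rfl
          exact hb hi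
        simp only [h0, zero_mul]
      · rw [ht1 i hi, mul_one]
    have h1 := congrFun (congrFun hPiP b) a
    rw [Matrix.mul_apply, Matrix.one_apply] at h1
    rw [hsum, h1, ht1 b hb, inv_one, one_mul, sub_self]

/-- **Reduction of clean pattern-torus stability to Hom-stability.**  With `Pi * P = 1`, coordinate
`ess`-columns of `P`, Hom-stability of `J'` (stability under `linSubst (1 + C)` for every `C`
supported on `¬ess`-rows × `ess`-columns) and a clean `t` (`t ≠ 0`, `t = 1` off `ess`):
if `linSubst ((Pi * diagonal t * P)ᵀ) D ∈ J' k` then `linSubst (diagonal t) D ∈ J' k`, because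
`Pi * diagonal t * P = diagonal t * (1 + E)` with `E` supported on `ess × ¬ess`, so
`(Pi * diagonal t * P)ᵀ = (1 + Eᵀ) * diagonal t` and `1 + Eᵀ` is inverted by `1 - Eᵀ`. [folklore] -/
theorem stabTorus_reduction {σ : Type*} [Fintype σ] [DecidableEq σ] (ess : σ → Prop)
    (J' : ℕ → Set (MvPolynomial σ ℂ)) (m : ℕ) (P Pi : Matrix σ σ ℂ) (hPiP : Pi * P = 1)
    (hPcol : ∀ a, ess a → ∀ b, P b a = if b = a then 1 else 0)
    (hSH : ∀ C : Matrix σ σ ℂ, (∀ j i, C j i ≠ 0 → ¬ ess j ∧ ess i) →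
      ∀ k ≤ m, ∀ D ∈ J' k, linSubst σ ℂ (1 + C) D ∈ J' k)
    (t : σ → ℂ) (ht0 : ∀ i, t i ≠ 0) (ht1 : ∀ z, ¬ ess z → t z = 1)
    (k : ℕ) (hk : k ≤ m) (D : MvPolynomial σ ℂ)
    (hmem : linSubst σ ℂ (Pi * Matrix.diagonal t * P)ᵀ D ∈ J' k) :
    linSubst σ ℂ (Matrix.diagonal t) D ∈ J' k := by
  -- the correction matrix `E` and its support
  obtain ⟨E, hEdef⟩ : ∃ E : Matrix σ σ ℂ,
      E = Matrix.diagonal (fun i => (t i)⁻¹) * (Pi * Matrix.diagonal t * P) - 1 := ⟨_, rfl⟩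
  have hE : ∀ b a, E b a ≠ 0 → ess b ∧ ¬ ess a := by
    rw [hEdef]
    exact stabTorus_corr_support ess P Pi hPiP hPcol t ht0 ht1
  have hEE : E * E = 0 := stabTorus_mul_self_eq_zero ess E hE
  have hEtEt : Eᵀ * Eᵀ = 0 := by
    rw [← Matrix.transpose_mul, hEE, Matrix.transpose_zero]
  -- the key matrix identity `Pi * Dt * P = Dt * (1 + E)`
  have hDD : Matrix.diagonal t * Matrix.diagonal (fun i => (t i)⁻¹) = 1 := by
    rw [Matrix.diagonal_mul_diagonal, ← Matrix.diagonal_one]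
    congr 1
    funext i
    exact mul_inv_cancel₀ (ht0 i)
  have hkey : Pi * Matrix.diagonal t * P = Matrix.diagonal t * (1 + E) := by
    rw [hEdef, add_sub_cancel, ← Matrix.mul_assoc, hDD, Matrix.one_mul]
  have htr : (Pi * Matrix.diagonal t * P)ᵀ = (1 + Eᵀ) * Matrix.diagonal t := by
    rw [hkey, Matrix.transpose_mul, Matrix.transpose_add, Matrix.transpose_one,
      Matrix.diagonal_transpose]
  rw [htr, linSubst_mul, AlgHom.comp_apply] at hmem
  -- remove the factor `1 + Eᵀ` by Hom-stability with `C := -Eᵀ`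
  have hC : ∀ j i, (-Eᵀ) j i ≠ 0 → ¬ ess j ∧ ess i := fun j i h => by
    rw [Matrix.neg_apply, Matrix.transpose_apply, neg_ne_zero] at h
    exact ⟨(hE i j h).2, (hE i j h).1⟩
  have h2 := hSH (-Eᵀ) hC k hk _ hmem
  rwa [stabTorus_linSubst_cancel Eᵀ hEtEt] at h2

/-- **Stub 5 — pattern-torus stability (unpacking W4, II).**  Under the hypotheses of stub 4 and its
conclusion (Hom-stability), `J'` is stable under the CLEAN pattern torus: `∂_v ↦ t_v ∂_v` with `t = 1`
on the unused variables, rank-one on the per-block (`t_(i,j) t_(k,l) = t_(i,l) t_(k,j)`) and of character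
`t₀₀^{m-n} Π_i t_(i,i) = 1`: `diag(t) ∈ H₀`, `p⁻¹ diag(t) p = diag(t) · (1 + E)` with `E` supported on
own rows × unused columns, and the factor `(1 + E)ᵀ` is removed by Hom-stability. [folklore] -/
theorem stub_stabTorus : ∀ (n m : ℕ) [NeZero m] (p : GL (Fin m × Fin m) ℂ)
    (J' : ℕ → Set (MvPolynomial (Fin m × Fin m) ℂ)),
    (∀ a : Fin m × Fin m, ((m - n ≤ (a.1 : ℕ) ∧ m - n ≤ (a.2 : ℕ)) ∨ a = (0, 0)) →
      ∀ b : Fin m × Fin m, (p : Matrix (Fin m × Fin m) (Fin m × Fin m) ℂ) b a = if b = a then 1 else 0) →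
    (∀ A : Matrix.GeneralLinearGroup (Fin m × Fin m) ℂ,
      let M : Matrix (Fin m × Fin m) (Fin m × Fin m) ℂ := A
      let rk := fun (q : Fin m × Fin m) =>
        (if (m - n ≤ (q.1 : ℕ) ∧ m - n ≤ (q.2 : ℕ)) ∨ q = (0, 0) then 0 else m * m) + ((q.1 : ℕ) * m + (q.2 : ℕ))
      (∀ i j : Fin m × Fin m, M j i ≠ 0 → rk j ≤ rk i) →
      (∀ i j : Fin m × Fin m, ((m - n ≤ (i.1 : ℕ) ∧ m - n ≤ (i.2 : ℕ)) ∨ i = (0, 0)) → j ≠ i → M j i = 0) →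
      (∀ i k j l : Fin m, m - n ≤ (i : ℕ) → m - n ≤ (k : ℕ) → m - n ≤ (j : ℕ) → m - n ≤ (l : ℕ) →
        M (i, j) (i, j) * M (k, l) (k, l) = M (i, l) (i, l) * M (k, j) (k, j)) →
      M (0, 0) (0, 0) ^ (m - n) * ∏ i ∈ Finset.univ.filter (fun i : Fin m => m - n ≤ (i : ℕ)), M (i, i) (i, i) = 1 →
      ∀ k ≤ m, ∀ D ∈ J' k,
        linSubst (Fin m × Fin m) ℂ (((p⁻¹ : GL (Fin m × Fin m) ℂ) : Matrix (Fin m × Fin m) (Fin m × Fin m) ℂ) *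
          M * (p : Matrix (Fin m × Fin m) (Fin m × Fin m) ℂ))ᵀ D ∈ J' k) →
    (∀ C : Matrix (Fin m × Fin m) (Fin m × Fin m) ℂ,
      (∀ j i : Fin m × Fin m, C j i ≠ 0 →
        ¬ (((m - n ≤ (j.1 : ℕ) ∧ m - n ≤ (j.2 : ℕ)) ∨ j = (0, 0))) ∧
          (((m - n ≤ (i.1 : ℕ) ∧ m - n ≤ (i.2 : ℕ)) ∨ i = (0, 0)))) →
      ∀ k ≤ m, ∀ D ∈ J' k, linSubst (Fin m × Fin m) ℂ (1 + C) D ∈ J' k) →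
    ∀ t : Fin m × Fin m → ℂ, (∀ i, t i ≠ 0) →
      (∀ z : Fin m × Fin m, ¬ (((m - n ≤ (z.1 : ℕ) ∧ m - n ≤ (z.2 : ℕ)) ∨ z = (0, 0))) → t z = 1) →
      (∀ i k j l : Fin m, m - n ≤ (i : ℕ) → m - n ≤ (k : ℕ) → m - n ≤ (j : ℕ) → m - n ≤ (l : ℕ) →
        t (i, j) * t (k, l) = t (i, l) * t (k, j)) →
      t (0, 0) ^ (m - n) * ∏ i ∈ Finset.univ.filter (fun i : Fin m => m - n ≤ (i : ℕ)), t (i, i) = 1 →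
      ∀ k ≤ m, ∀ D ∈ J' k, linSubst (Fin m × Fin m) ℂ (Matrix.diagonal t) D ∈ J' k := by
  intro n m _ p J' hP1 hraw hSH t ht0 ht1 htc htd k hk D hD
  -- `Dt := diagonal t` as an element of `GL`
  have hdet : (Matrix.diagonal t).det ≠ 0 := by
    rw [Matrix.det_diagonal]
    exact Finset.prod_ne_zero_iff.mpr fun i _ => ht0 i
  have h := hraw (Matrix.GeneralLinearGroup.mkOfDetNeZero _ hdet)
  simp only [Matrix.GeneralLinearGroup.val_mkOfDetNeZero] at h
  -- reduce to the raw stability of `(p⁻¹ Dt p)ᵀ`, then check the four `H₀` clauses for `Dt`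
  refine stabTorus_reduction (fun a : Fin m × Fin m => (m - n ≤ (a.1 : ℕ) ∧ m - n ≤ (a.2 : ℕ)) ∨ a = (0, 0))
    J' m _ _ p.inv_mul hP1 hSH t ht0 ht1 k hk D ?_
  refine h ?_ ?_ ?_ ?_ k hk D hD
  · -- (a) diagonal matrices are triangular
    intro i j hij
    by_cases hji : j = i
    · subst hji
      exact le_rfl
    · exact (hij (Matrix.diagonal_apply_ne _ hji)).elim
  · -- (b) diagonal
    intro i j _ hji
    exact Matrix.diagonal_apply_ne _ hji
  · -- (c) rank-one pattern on the `Y`-diagonal: the hypothesis on `t`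
    intro i k' j l hi hk' hj hl
    simp only [Matrix.diagonal_apply_eq]
    exact htc i k' j l hi hk' hj hl
  · -- (d) character `1`: the hypothesis on `t`
    simp only [Matrix.diagonal_apply_eq]
    exact htd

end Summit.ValiantsHypothesis.ValiantsHypothesis.Theorems.BorderApolarityToricWitnessObstructionQP
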